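import Summits.Parity.GeneralizedHardyLittlewood.Theses.GreenTaoLevelTwo
import Summits.Parity.GeneralizedHardyLittlewood.Theorems.GreenTaoLevelTwoAssembly
import Summits.Parity.GeneralizedHardyLittlewood.Theorems.GreenTaoLevelTwoHeisMetricExists
import Summits.Parity.GeneralizedHardyLittlewood.Theorems.GreenTaoLevelTwoGITwo
import Summits.Parity.GeneralizedHardyLittlewood.Theorems.GreenTaoLevelTwoMNTwo
import Summits.Parity.GeneralizedHardyLittlewood.Theorems.GreenTaoLevelTwoSharpTwo
import HarnessLib

/-!
# Route `GreenTaoLevelTwo` — the rung leaf `MainTheoremLeFour`, UNCONDITIONAL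

The route `GreenTaoLevelTwo` closes the FRONTIER rung leaf F-GT2 of `Parity`, the Literature-level
statement `Literature.NumberTheory.Sieve.GreenTaoLevelTwo.MainTheoremLeFour` (Green–Tao 2010, Main
Theorem = Thm. 1.8, for every non-degenerate finite-complexity system of `t ≤ 4` affine-linear forms:
`|Σ_{n ∈ K ∩ ℤ^d} Π_i Λ(ψ_i(n)) − β_∞ Π_p β_p| ≤ ε N^d` for `N ≥ N₀(d, t, L, ε)`), through its deciding
theorem `Theses.GreenTaoLevelTwo.closes : Assembly → HeisMetricExists → GITwo → MNTwo → SharpTwo →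
MainTheoremLeFour`.  All five route items are landed:

* `Assembly` (stmt-Parity-21279) — `Theorems.greenTaoLevelTwo_assembly_proof`;
* `HeisMetricExists` (stmt-Parity-21278) — `Theorems.greenTaoLevelTwo_heisMetricExists_proof`;
* `GITwo` (stmt-Parity-21275, the `U³[N]` inverse theorem on the Heisenberg class) — `GITwo_proof`;
* `MNTwo` (stmt-Parity-21276, Möbius orthogonal to `2`-step nilsequences on the Heisenberg class) —
  `MNTwo_proof`;
* `SharpTwo` (stmt-Parity-21277, the sharp estimate (12.6)₂) — `Theorems.greenTaoLevelTwo_sharpTwo_proof`.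

This file composes them into the unconditional leaf

* `mainTheoremLeFour_proof : Literature.NumberTheory.Sieve.GreenTaoLevelTwo.MainTheoremLeFour`,

the declaration a success close of the route (`--proved …mainTheoremLeFour_proof`) names.

Honesty label (ROUND-6 §0): FORMALISATION of printed theorems (Green–Tao, Ann. of Math. 171 (2010)
Main Theorem for `t ≤ 4`; Proc. Edinb. Math. Soc. 51 (2008) `U³` inverse theorem; Ann. Inst. Fourier
58 (2008) quadratic Möbius; Ann. of Math. 175 (2012) Lemma 3.7); rung F-GT2 only — the `Parity`
summit / GHL is NOT proved and no summit credit is claimed.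

References: [GreenTao2010, Main Theorem (Thm. 1.8), Conj. 8.3–8.5, (12.6)];
[GreenTao2008U3Inverse, Thm. 12.8]; [GreenTao2008QuadraticMobius, Thm. 1.1];
[GreenTao2012Mobius, Lemma 3.7].
-/

namespace Summit.Parity.GeneralizedHardyLittlewood.Theses.GreenTaoLevelTwo

/-- **The Green–Tao 2010 Main Theorem for systems of `t ≤ 4` forms, unconditional** (rung leaf F-GT2
of `Parity`): `Literature.NumberTheory.Sieve.GreenTaoLevelTwo.MainTheoremLeFour`, obtained by feeding
the five landed item proofs of route `GreenTaoLevelTwo` — `greenTaoLevelTwo_assembly_proof`,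
`greenTaoLevelTwo_heisMetricExists_proof`, `GITwo_proof`, `MNTwo_proof`,
`greenTaoLevelTwo_sharpTwo_proof` — to the route's deciding theorem `closes`.
[cite: GreenTao2010, Main Theorem (Thm. 1.8)] -/
theorem mainTheoremLeFour_proof :
    Literature.NumberTheory.Sieve.GreenTaoLevelTwo.MainTheoremLeFour :=
  closes
    Summit.Parity.GeneralizedHardyLittlewood.Theorems.greenTaoLevelTwo_assembly_proof
    Summit.Parity.GeneralizedHardyLittlewood.Theorems.greenTaoLevelTwo_heisMetricExists_proof
    GITwo_proof
    MNTwo_proof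
    Summit.Parity.GeneralizedHardyLittlewood.Theorems.greenTaoLevelTwo_sharpTwo_proof

end Summit.Parity.GeneralizedHardyLittlewood.Theses.GreenTaoLevelTwo
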